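/-
Copyright: the b2b-balaban T⁴-continuum CRUX team, row NE7b OWNER lineage `t4-ne7b-p1` (gen 123). Project licence.
-/
import Summits.QuantumFields.BalabanUV.T4Continuum.Spine.NE7b.SupTorusGradientRoad
import Summits.QuantumFields.BalabanUV.T4Continuum.Spine.NE7b.SupTorusPerturbedPointwiseDecay

/-!
# BLOCK-SCALE GRADIENT DECAY FOR THE PERTURBED ROAD `H + K` ON THE CLASS `−λ ≤ V ≤ Λ`, `d ≥ 3`: `|K(x,z)| ≤ εe^{−γρ_N(x,z)}` (`γ > 1`,
# `εK_{γ−1} ≤ (min(2,a) − λ)∕4`), `|f| ≤ M·e^{−γ′ρ_s(bt ·, y₀)}`, `(H + K)u = f` ⟹ `e^{δρ_s(bt x, y₀)}·(n+1)·|u(x + ê_μ) − u(x)| ≤ C·M` at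
# every site and direction, `(C, δ)` from `(d, a, λ, Λ, ε, γ, γ′)` and `C(d)` only, every mesh, every volume — (156) `gradient_decay_road`
# RE-RUN for `H + K`: the gradient half of `interior_estimate` on the periodic lift with (174)'s pointwise decay as input and the kernel
# term absorbed into the cube data like the potential term ((172)∕(173)) (row NE7b, node U5c; (153)∕(156)∕(172)∕(173)∕(174) BY NAME;
# [folklore])

Cell `pub-balaban`, sub-cell `t4`, spine estimate NE7b (`T4WeightBudget.RelWeightBound`; the cell's OWN estimate — NOT PRINTED in
[Bałaban 1983–89], NOT PROVED).  Crux-route work under `Spine/NE7b/` by the row OWNER (`t4-ne7b-p1` gen 123, file (176)) under FREEZE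
(0)'s crux-prover clause; NOTHING of Bałaban's is named as a Lean object, valued or asserted; no `T4Continuum/Support` leaf typed; no `def`,
no notation (the action `(H + K)u` DISPLAYED exactly as in (162)–(175)); zero `sorry`.  Imports (BY NAME): the OWNER's (156)
`…SupTorusGradientRoad` (`bt_step_dist_le`; through it (153) `near_dist_le`, `sum_cube_le_of_near`, (151) `lap_lift`, `blk_near_of_mem_cube`,
(132) `isPseudoDist_torus`, (131) `exists_rate`, the torus dictionary and the β-team's `Beta.PoissonInterior.interior_estimate` — the
inhomogeneous interior estimate for the lattice Poisson equation on `ℤ^d`, `d ≥ 3`, [folklore], with its gradient half), (174)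
`…SupTorusPerturbedPointwiseDecay` (`perturbed_pointwise_decay`; through it (173) `perturbed_blockL1_le_of_supProfile`,
`perturbed_blockMean_le_of_supProfile`, `perturbed_laplacian_site_le`, (172) `kernel_supProfile_le`, (168) `kernelSum_anti`).

WHY (located).  (171) `perturbed_gradient_bound` is the `ℓ^∞` gradient letter of `H + K` (by perturbation of (156) §2); the DECAYING
gradient, like the decay itself, does not follow by perturbation in a weighted norm (rate loss) and is re-run: with (174)
`|u| ≤ C₀Me^{−δρ_s(bt ·, y₀)}` as input, every datum of `interior_estimate` on the cube of radius `3m`, `m = ⌊(n+1)∕3⌋`, about a representative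
of `x` carries `e^{dδ}e^{−δρ_s(bt x, y₀)}`: the source, the zeroth-order term `|Vu| ≤ LC₀M·(…)`, the KERNEL term `|Ku| ≤ εK_{γ−δ}e^{2dδ}C₀M·(…)`
((172)), the block means and block-`ℓ¹` norms ((173)); the gradient half `|∇(u∘σ)(q₀)| ≤ C(d)(mA + B∕m^{d+1})` then gives the increment
`≤ C·M·e^{−δρ_s}∕(n+1)`.  Small meshes (`n + 1 < 6`) are read off the decay of the two values ((156) §1 `bt_step_dist_le`).

WHAT IS PROVED ([folklore]; fine torus `Site d ((n+1)s)`, coarse `Site d s`, `[NeZero s]`; `(H + K)u` DISPLAYED; `σ = siteOf`, `ê_μ = σ(e μ)`,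
`bt x = σ_s(blk n (wm x))`, `ρ_s` the `ℓ¹` circular distance; `K_α = (2∕(1 − e^{−α}))^d`):
* §1 THE HEADLINE **`perturbed_gradient_decay`**: `d ≥ 3`, `a > 0`, `λ < min(2,a)`, `Λ ≥ 0`, `γ′ > 0`, `ε ≥ 0`, `γ > 1`, `εK_{γ−1} ≤
  (min(2,a) − λ)∕4` ⟹ `∃ C δ > 0`: ALL `n, s`, ALL `−λ ≤ V ≤ Λ`, ALL kernels `|K(x,z)| ≤ εe^{−γρ_N(x,z)}`, every `y₀`, EVERY
  `|f| ≤ M·e^{−γ′ρ_s(bt ·, y₀)}`, every `(H + K)u = f`, `x, μ`: `e^{δρ_s(bt x, y₀)}·(n+1)·|u(x + ê_μ) − u(x)| ≤ C·M`.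
* §2 toy (`d = 3`).

HONEST (what this is NOT).  First differences only; `d ≥ 3` only; constants existential and far from sharp; SMALL kernels with the exact
lattice Laplacian as main part; cubic periods; scalar skeleton ((A3), NC-NE7b-α UNRULED); nothing of the covariant propagators of [B4]–[B6];
nothing of Bałaban's.  BY-NAME EFFECT ON THE WALL: NONE.  NE7b NOT PRINTED ∕ NOT PROVED; spine PROVED 0∕9; rung (B)+1 on a FINITE torus — NOT
infinite volume, NOT the mass gap, NOT Clay.  HONEST DEPENDENCY: continuum YM on T⁴ ⇐ BetaPertH ∧ nine spine estimates (0∕9 proved);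
BetaPertH ⇐ (D1) ∧ (D4) ∧ CAP+tail; G-an2-4 gates asym, D1 and NE2∕3∕4.
-/

set_option autoImplicit false

noncomputable section

namespace Summit.QuantumFields.BalabanUV.T4Continuum.NE7b.SupTorusPerturbedGradientDecay

open Real
open Literature.MathematicalPhysics.QuantumFieldTheory.Balaban1983to89
open Literature.Probability.LatticeModels (latticeLaplacianZd)
open B6QGQLower276 (X e blk B side chart mem_B sum_B sum_B_const card_cube blk_chart)
open Beta (Site siteOf windowMap siteOf_windowMap siteOf_add siteOf_sub)
open Beta.PoissonInterior (cube mem_cube interior_estimate)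
open SupTorusDirichletForm (siteOf_chart_surjective blockOf_siteOf_of_mem blockOf_siteOf)
open SupTorusDirichletFormCoercive (comp_siteOf_periodic)
open PeriodicSupTorusCarrier (exists_windowMap_siteOf)
open OneShotChartTorusRowsZd (sum_B_translate)
open SupTorusHessianCombesThomas (exists_rate)
open SupTorusBlockDistance (isPseudoDist_torus)
open SupTorusBlockL1Letter (lap_lift blk_near_of_mem_cube)
open SupTorusBlockL1Profile (near_dist_le sum_cube_le_of_near)
open SupTorusGradientRoad (bt_step_dist_le)
open SupTorusPerturbedResponse (kernelSum_anti)
open SupTorusPerturbedKernelProfile (kernel_supProfile_le)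
open SupTorusPerturbedBlockL1Profile (perturbed_blockL1_le_of_supProfile perturbed_blockMean_le_of_supProfile
  perturbed_laplacian_site_le)
open SupTorusPerturbedPointwiseDecay (perturbed_pointwise_decay)

variable {d : ℕ}

/-! ## §1. THE END: the decaying gradient of `(H + K)⁻¹f` for sources with an exponential sup profile -/

set_option maxHeartbeats 400000 in
/-- **HEADLINE — `e^{δρ_s(bt x, y₀)}·(n+1)·|u(x + ê_μ) − u(x)| ≤ C·M` ON THE ROAD'S CLASS `−λ ≤ V ≤ Λ`, FOR EVERY KERNEL
`|K(x,z)| ≤ εe^{−γρ_N(x,z)}` WITH `γ > 1`, `εK_{γ−1} ≤ (min(2,a) − λ)∕4`, `d ≥ 3`, every mesh, every volume**, for `|f| ≤ M·e^{−γ′ρ_s(bt ·, y₀)}`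
and `(H + K)u = f`: the gradient half of `interior_estimate` on the periodic lift with (174) `perturbed_pointwise_decay` as input, the kernel
term `|Ku| ≤ εK_{γ−δ}e^{2dδ}C₀Me^{−δρ_s}` ((172)) entering the cube data like the potential term, the block letters from (173); every block met
is within `ρ_s`-distance `d` of `bt x` ((153) `near_dist_le`, (156) `bt_step_dist_le`). [folklore] -/
theorem perturbed_gradient_decay (hd : 3 ≤ d) (a : ℝ) (ha : 0 < a) {lam Lam ε γ γ' : ℝ} (hlam : lam < min 2 a) (hLam : 0 ≤ Lam)
    (hγ' : 0 < γ') (hε : 0 ≤ ε) (hγ : 1 < γ) (hεs : ε * (2 * (1 - exp (-(γ - 1)))⁻¹) ^ d ≤ (min 2 a - lam) / 4) :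
    ∃ C δ : ℝ, 0 < C ∧ 0 < δ ∧ ∀ (n s : ℕ) [NeZero s] (V : Site d ((n + 1) * s) → ℝ), (∀ x, -lam ≤ V x) → (∀ x, V x ≤ Lam) →
      ∀ K : Site d ((n + 1) * s) → Site d ((n + 1) * s) → ℝ,
      (∀ x z, |K x z| ≤ ε * exp (-(γ * ∑ i, (((x i - z i).valMinAbs.natAbs : ℕ) : ℝ)))) →
      ∀ (y₀ : Site d s) (M : ℝ) (u f : Site d ((n + 1) * s) → ℝ),
      (∀ x, |f x| ≤ M * exp (-(γ' * ∑ i, ((((siteOf d s (blk n (windowMap d ((n + 1) * s) x))) i - y₀ i).valMinAbs.natAbs : ℕ) : ℝ)))) →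
      (∀ x, ((n : ℝ) + 1) ^ 2 * ∑ μ, (2 * u x - u (x + siteOf d ((n + 1) * s) (e μ)) - u (x - siteOf d ((n + 1) * s) (e μ)))
        + a / ((n : ℝ) + 1) ^ d * ∑ q ∈ B n (blk n (windowMap d ((n + 1) * s) x)), u (siteOf d ((n + 1) * s) q) + V x * u x
        + ∑ z, K x z * u z = f x) →
      ∀ (x : Site d ((n + 1) * s)) (μ : Fin d),
        exp (δ * ∑ i, ((((siteOf d s (blk n (windowMap d ((n + 1) * s) x))) i - y₀ i).valMinAbs.natAbs : ℕ) : ℝ))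
          * (((n : ℝ) + 1) * |u (x + siteOf d ((n + 1) * s) (e μ)) - u x|) ≤ C * M := by
  classical
  have hdR : (0 : ℝ) ≤ d := Nat.cast_nonneg d
  have hm0 : 0 < min 2 a - lam := by linarith
  obtain ⟨κ, hκ0, hκ1, hκm⟩ := exists_rate (d := d) a ha.le hm0
  -- the profile rate `δ₁ = min(κ, γ′∕2)` of the block data and the perturbed floor at that rate
  set δ₁ : ℝ := min κ (γ' / 2) with hδ₁_def
  have hδ₁0 : 0 < δ₁ := lt_min hκ0 (by linarith)
  have hδ₁κ : δ₁ ≤ κ := min_le_left _ _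
  have h2δ₁ : 2 * δ₁ ≤ γ' := by have := min_le_right κ (γ' / 2); rw [← hδ₁_def] at this; linarith
  have hδ₁1 : δ₁ ≤ 1 := hδ₁κ.trans hκ1
  have hδ₁γ : δ₁ < γ := lt_of_le_of_lt hδ₁1 hγ
  have hmono1 : δ₁ ^ 2 ≤ κ ^ 2 := pow_le_pow_left₀ hδ₁0.le hδ₁κ 2
  have hmono2 : exp (2 * d * δ₁) ≤ exp (2 * d * κ) := exp_le_exp.2 (by nlinarith)
  have hmδ₁ : (min 2 a - lam) / 2 ≤ min 2 a - lam - 2 * d * δ₁ ^ 2 - a * (exp (2 * d * δ₁) - 1) := by nlinarith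
  have hKmono1 : (2 * (1 - exp (-(γ - δ₁)))⁻¹) ^ d ≤ (2 * (1 - exp (-(γ - 1)))⁻¹) ^ d :=
    kernelSum_anti (d := d) (by linarith) (by linarith)
  have hεδ₁ : ε * (2 * (1 - exp (-(γ - δ₁)))⁻¹) ^ d ≤ (min 2 a - lam) / 4 := (mul_le_mul_of_nonneg_left hKmono1 hε).trans hεs
  have hfl : ε * (2 * (1 - exp (-(γ - δ₁)))⁻¹) ^ d < min 2 a - lam - 2 * d * δ₁ ^ 2 - a * (exp (2 * d * δ₁) - 1) := by linarith
  set mδ : ℝ := min 2 a - lam - 2 * d * δ₁ ^ 2 - a * (exp (2 * d * δ₁) - 1) - ε * (2 * (1 - exp (-(γ - δ₁)))⁻¹) ^ d with hmδ_def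
  have hmδpos : 0 < mδ := by rw [hmδ_def]; linarith
  have hminv : 0 ≤ mδ⁻¹ := inv_nonneg.2 hmδpos.le
  set K2 : ℝ := (2 * (1 - exp (-(2 * δ₁)))⁻¹) ^ d with hK2
  have hK20 : 0 ≤ K2 := pow_nonneg (mul_nonneg zero_le_two (inv_nonneg.2 (sub_nonneg.2 (exp_le_one_iff.2 (by linarith))))) d
  set Cd : ℝ := mδ⁻¹ * exp (2 * d * δ₁) * K2 with hCd
  have hCd0 : 0 ≤ Cd := by positivity
  -- (174) as input, and the final rate `δ = min(δ₁, δ₂)`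
  obtain ⟨C₀, δ₂, hC₀, hδ₂, H0⟩ := perturbed_pointwise_decay (d := d) hd a ha hlam hLam hγ' hε hγ hεs
  set δ : ℝ := min δ₁ δ₂ with hδ_def
  have hδ0 : 0 < δ := lt_min hδ₁0 hδ₂
  have hδδ₁ : δ ≤ δ₁ := min_le_left _ _
  have hδδ₂ : δ ≤ δ₂ := min_le_right _ _
  have hδγ' : δ ≤ γ' := by linarith
  have hδγ : δ < γ := lt_of_le_of_lt (hδδ₁.trans hδ₁1) hγ
  -- the kernel letter's constant at the rate `δ`
  set Kk : ℝ := ε * (2 * (1 - exp (-(γ - δ)))⁻¹) ^ d * exp (2 * d * δ) with hKk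
  have hKk0 : 0 ≤ Kk :=
    mul_nonneg (mul_nonneg hε (pow_nonneg (mul_nonneg zero_le_two (inv_nonneg.2 (sub_nonneg.2 (exp_le_one_iff.2 (by linarith))))) d))
      (exp_pos _).le
  set E : ℝ := exp (d * δ) with hE
  have hE1 : 1 ≤ E := one_le_exp (by positivity)
  obtain ⟨CI, hCI0, hI⟩ := interior_estimate hd
  set L : ℝ := |lam| + Lam with hL
  have hL0 : 0 ≤ L := by positivity
  set L' : ℝ := L + Kk with hL'
  have hL'0 : 0 ≤ L' := by positivity
  set K₁ : ℝ := 6 * ((E + 1) * C₀) with hK₁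
  set K₂ : ℝ := CI * E * ((1 / 3) * (1 + L' * C₀ + a * Cd) + 3 ^ d * Cd * 6 ^ (d + 1)) with hK₂
  refine ⟨max K₁ K₂ + 1, δ, by positivity, hδ0, ?_⟩
  intro n s _ V hV hV' K hK y₀ M u f hf hu x μ
  have hP := isPseudoDist_torus (d := d) s
  have hM : 0 ≤ M := by
    have h1 := (abs_nonneg _).trans (hf x)
    exact le_of_mul_le_mul_right (by rw [zero_mul]; exact h1) (exp_pos _)
  have hn1 : (0 : ℝ) < (n : ℝ) + 1 := by positivity
  have hVabs : ∀ x', |V x'| ≤ L := fun x' => by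
    rw [hL, abs_le]; constructor <;> linarith [hV x', hV' x', le_abs_self lam, neg_abs_le lam]
  -- (174) as input, at the smaller rate `δ`
  have hS : ∀ x', |u x'| ≤ exp (-(δ * ∑ i, ((((siteOf d s (blk n (windowMap d ((n + 1) * s) x'))) i - y₀ i).valMinAbs.natAbs : ℕ) : ℝ)))
      * (C₀ * M) := fun x' => by
    have h := H0 n s V hV hV' K hK y₀ M u f hf hu x'
    have hρ : 0 ≤ ∑ i, ((((siteOf d s (blk n (windowMap d ((n + 1) * s) x'))) i - y₀ i).valMinAbs.natAbs : ℕ) : ℝ) :=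
      Finset.sum_nonneg fun _ _ => Nat.cast_nonneg _
    rw [exp_neg, ← div_eq_inv_mul, le_div_iff₀ (exp_pos _), mul_comm]
    refine le_trans ?_ h
    refine mul_le_mul_of_nonneg_right (exp_le_exp.2 ?_) (abs_nonneg _)
    exact mul_le_mul_of_nonneg_right hδδ₂ hρ
  have hS' : ∀ x', |u x'| ≤ (C₀ * M)
      * exp (-(δ * ∑ i, ((((siteOf d s (blk n (windowMap d ((n + 1) * s) x'))) i - y₀ i).valMinAbs.natAbs : ℕ) : ℝ))) :=
    fun x' => by rw [mul_comm]; exact hS x'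
  -- the kernel term has the profile of `u` ((172))
  have hKu : ∀ x', |∑ z, K x' z * u z|
      ≤ Kk * (C₀ * M) * exp (-(δ * ∑ i, ((((siteOf d s (blk n (windowMap d ((n + 1) * s) x'))) i - y₀ i).valMinAbs.natAbs : ℕ) : ℝ))) :=
    fun x' => by
    have h := kernel_supProfile_le n s hε hδ0.le hδγ K hK y₀ u hS' x'
    rw [hKk]
    calc _ ≤ _ := h
      _ = _ := by ring
  set ρx : ℝ := ∑ i, ((((siteOf d s (blk n (windowMap d ((n + 1) * s) x))) i - y₀ i).valMinAbs.natAbs : ℕ) : ℝ) with hρx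
  -- the profile factor of a block within `ρ_s`-distance `d` of `bt x`
  have hfac : ∀ y' : Site d s, ∑ i, (((y' i - (siteOf d s (blk n (windowMap d ((n + 1) * s) x))) i).valMinAbs.natAbs : ℕ) : ℝ) ≤ d →
      exp (-(δ * ∑ i, (((y' i - y₀ i).valMinAbs.natAbs : ℕ) : ℝ))) ≤ E * exp (-(δ * ρx)) := fun y' hy' => by
    have htri : ρx ≤ ∑ i, ((((siteOf d s (blk n (windowMap d ((n + 1) * s) x))) i - y' i).valMinAbs.natAbs : ℕ) : ℝ)
        + ∑ i, (((y' i - y₀ i).valMinAbs.natAbs : ℕ) : ℝ) := hP.triangle _ y' y₀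
    have hsymm : ∑ i, ((((siteOf d s (blk n (windowMap d ((n + 1) * s) x))) i - y' i).valMinAbs.natAbs : ℕ) : ℝ)
        = ∑ i, (((y' i - (siteOf d s (blk n (windowMap d ((n + 1) * s) x))) i).valMinAbs.natAbs : ℕ) : ℝ) := hP.symm _ y'
    rw [hE, ← exp_add]; rw [hsymm] at htri
    exact exp_le_exp.2 (by linarith [mul_le_mul_of_nonneg_left htri hδ0.le, mul_le_mul_of_nonneg_left hy' hδ0.le])
  suffices hmain : exp (δ * ρx) * (((n : ℝ) + 1) * |u (x + siteOf d ((n + 1) * s) (e μ)) - u x|) ≤ max K₁ K₂ * M by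
    refine hmain.trans ?_; rw [add_mul, one_mul]; linarith
  have hw0 : exp (δ * ρx) * exp (-(δ * ρx)) = 1 := by rw [← exp_add, add_neg_cancel, exp_zero]
  -- the two values entering the increment carry `E·e^{−δρx}`
  have hux0 : |u x| ≤ exp (-(δ * ρx)) * (C₀ * M) := by rw [hρx]; exact hS x
  have hux1 : |u (x + siteOf d ((n + 1) * s) (e μ))| ≤ E * exp (-(δ * ρx)) * (C₀ * M) :=
    (hS _).trans (mul_le_mul_of_nonneg_right (hfac _ (bt_step_dist_le n s x μ)) (by positivity))
  by_cases hsmall : (1 / 3 : ℝ) * ((n : ℝ) + 1) < 2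
  · -- small meshes
    have h2 : (n : ℝ) + 1 ≤ 6 := by linarith
    have h1 : |u (x + siteOf d ((n + 1) * s) (e μ)) - u x| ≤ (E + 1) * (exp (-(δ * ρx)) * (C₀ * M)) := by
      refine (abs_sub _ _).trans ?_
      linarith
    calc exp (δ * ρx) * (((n : ℝ) + 1) * |u (x + siteOf d ((n + 1) * s) (e μ)) - u x|)
        ≤ exp (δ * ρx) * (6 * ((E + 1) * (exp (-(δ * ρx)) * (C₀ * M)))) :=
          mul_le_mul_of_nonneg_left (mul_le_mul h2 h1 (abs_nonneg _) (by norm_num)) (exp_pos _).le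
      _ = (exp (δ * ρx) * exp (-(δ * ρx))) * (K₁ * M) := by rw [hK₁]; ring
      _ = K₁ * M := by rw [hw0, one_mul]
      _ ≤ max K₁ K₂ * M := mul_le_mul_of_nonneg_right (le_max_left _ _) hM
  · -- large meshes
    have hsmall' : 2 ≤ (1 / 3 : ℝ) * ((n : ℝ) + 1) := not_lt.1 hsmall
    set mm : ℕ := ⌊(1 / 3 : ℝ) * ((n : ℝ) + 1)⌋₊ with hmm
    have hmm_le : (mm : ℝ) ≤ (1 / 3) * ((n : ℝ) + 1) := Nat.floor_le (by positivity)
    have hmm_ge : (1 / 3 : ℝ) * ((n : ℝ) + 1) / 2 ≤ mm := by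
      have := Nat.lt_floor_add_one ((1 / 3 : ℝ) * ((n : ℝ) + 1)); rw [← hmm] at this; linarith
    have hmm2 : 2 ≤ mm := Nat.le_floor (by exact_mod_cast hsmall')
    have hmm1 : 1 ≤ mm := le_trans (by norm_num) hmm2
    have hmmR : (0 : ℝ) < mm := by exact_mod_cast (lt_of_lt_of_le zero_lt_one hmm1)
    have h3m : 3 * mm ≤ n + 1 := by exact_mod_cast (show ((3 * mm : ℕ) : ℝ) ≤ ((n + 1 : ℕ) : ℝ) by push_cast; linarith)
    -- the block means and block `ℓ¹` norms at the rate `δ₁ ≥ δ` ((173))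
    have hmean : ∀ y : Site d s, |(((n : ℝ) + 1) ^ d)⁻¹ * ∑ z : Fin d → Fin (n + 1), u (siteOf d ((n + 1) * s) (chart n (windowMap d s y) z))|
        ≤ Cd * M * exp (-(δ * ∑ i, (((y i - y₀ i).valMinAbs.natAbs : ℕ) : ℝ))) := fun y => by
      have h := perturbed_blockMean_le_of_supProfile n a s ha.le hδ₁0 hδ₁1 hδ₁γ hε hfl h2δ₁ V hV K hK y₀ u f hf hu y
      have hρ : 0 ≤ ∑ i, (((y i - y₀ i).valMinAbs.natAbs : ℕ) : ℝ) := Finset.sum_nonneg fun _ _ => Nat.cast_nonneg _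
      have hδe : exp (-(δ₁ * ∑ i, (((y i - y₀ i).valMinAbs.natAbs : ℕ) : ℝ))) ≤ exp (-(δ * ∑ i, (((y i - y₀ i).valMinAbs.natAbs : ℕ) : ℝ))) :=
        exp_le_exp.2 (by have := mul_le_mul_of_nonneg_right hδδ₁ hρ; linarith)
      rw [hCd]
      exact h.trans ((mul_le_mul_of_nonneg_left hδe (by positivity)).trans (le_of_eq (by ring)))
    have hL1 : ∀ b : X d, ∑ q ∈ B n b, |u (siteOf d ((n + 1) * s) q)|
        ≤ ((n : ℝ) + 1) ^ d * Cd * M * exp (-(δ * ∑ i, ((((siteOf d s b) i - y₀ i).valMinAbs.natAbs : ℕ) : ℝ))) := fun b => by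
      have h := perturbed_blockL1_le_of_supProfile n a s ha.le hδ₁0 hδ₁1 hδ₁γ hε hfl h2δ₁ V hV K hK y₀ u f hf hu (siteOf d s b)
      obtain ⟨t, ht⟩ := exists_windowMap_siteOf s b
      rw [← sum_B (windowMap d s (siteOf d s b)) (fun q => |u (siteOf d ((n + 1) * s) q)|), ht, sum_B_translate] at h
      simp only [comp_siteOf_periodic] at h
      have hρ : 0 ≤ ∑ i, ((((siteOf d s b) i - y₀ i).valMinAbs.natAbs : ℕ) : ℝ) := Finset.sum_nonneg fun _ _ => Nat.cast_nonneg _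
      have hδe : exp (-(δ₁ * ∑ i, ((((siteOf d s b) i - y₀ i).valMinAbs.natAbs : ℕ) : ℝ)))
          ≤ exp (-(δ * ∑ i, ((((siteOf d s b) i - y₀ i).valMinAbs.natAbs : ℕ) : ℝ))) :=
        exp_le_exp.2 (by have := mul_le_mul_of_nonneg_right hδδ₁ hρ; linarith)
      rw [hCd]
      exact h.trans ((mul_le_mul_of_nonneg_left hδe (by positivity)).trans (le_of_eq (by ring)))
    set q₀ : X d := windowMap d ((n + 1) * s) x with hq₀
    have hnear : ∀ b : X d, (∀ i, blk n q₀ i - 1 ≤ b i ∧ b i ≤ blk n q₀ i + 1) →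
        exp (-(δ * ∑ i, ((((siteOf d s b) i - y₀ i).valMinAbs.natAbs : ℕ) : ℝ))) ≤ E * exp (-(δ * ρx)) := fun b hb =>
      hfac (siteOf d s b) (near_dist_le s hb)
    obtain ⟨A, hA⟩ : ∃ A : ℝ, A = E * exp (-(δ * ρx)) * (M + L' * (C₀ * M) + a * (Cd * M)) / ((n : ℝ) + 1) ^ 2 := ⟨_, rfl⟩
    obtain ⟨Bsum, hB⟩ : ∃ Bsum : ℝ, Bsum = 3 ^ d * (((n : ℝ) + 1) ^ d * Cd * M * (E * exp (-(δ * ρx)))) := ⟨_, rfl⟩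
    have hlap : ∀ p ∈ cube q₀ (3 * mm), |latticeLaplacianZd (fun p' : X d => u (siteOf d ((n + 1) * s) p')) p| ≤ A := by
      intro p hp
      rw [lap_lift, abs_neg]
      obtain ⟨⟨y', z'⟩, hyz'⟩ := siteOf_chart_surjective n s (siteOf d ((n + 1) * s) p)
      simp only at hyz'
      have hbt' : siteOf d s (blk n (windowMap d ((n + 1) * s) (siteOf d ((n + 1) * s) p))) = y' := by
        rw [← hyz']; exact blockOf_siteOf_of_mem n s (mem_B.2 (blk_chart n (windowMap d s y') z'))
      have hy'b : y' = siteOf d s (blk n p) := by rw [← hbt', blockOf_siteOf]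
      have hw : exp (-(δ * ∑ i, (((y' i - y₀ i).valMinAbs.natAbs : ℕ) : ℝ))) ≤ E * exp (-(δ * ρx)) := by
        rw [hy'b]; exact hnear (blk n p) (blk_near_of_mem_cube h3m hp)
      have hfx := hf (siteOf d ((n + 1) * s) p)
      have hux := hS (siteOf d ((n + 1) * s) p)
      have hKx := hKu (siteOf d ((n + 1) * s) p)
      rw [hbt'] at hfx hux hKx
      rw [← hyz'] at hfx hux hKx ⊢
      have hρ' : 0 ≤ ∑ i, (((y' i - y₀ i).valMinAbs.natAbs : ℕ) : ℝ) := Finset.sum_nonneg fun _ _ => Nat.cast_nonneg _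
      have hγδ : exp (-(γ' * ∑ i, (((y' i - y₀ i).valMinAbs.natAbs : ℕ) : ℝ))) ≤ exp (-(δ * ∑ i, (((y' i - y₀ i).valMinAbs.natAbs : ℕ) : ℝ))) :=
        exp_le_exp.2 (by have := mul_le_mul_of_nonneg_right hδγ' hρ'; linarith)
      have k1 : |f (siteOf d ((n + 1) * s) (chart n (windowMap d s y') z'))| ≤ M * (E * exp (-(δ * ρx))) :=
        hfx.trans ((mul_le_mul_of_nonneg_left hγδ hM).trans (mul_le_mul_of_nonneg_left hw hM))
      have k2 : |u (siteOf d ((n + 1) * s) (chart n (windowMap d s y') z'))| ≤ E * exp (-(δ * ρx)) * (C₀ * M) :=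
        hux.trans (mul_le_mul_of_nonneg_right hw (by positivity))
      have k3 : |(((n : ℝ) + 1) ^ d)⁻¹ * ∑ z : Fin d → Fin (n + 1), u (siteOf d ((n + 1) * s) (chart n (windowMap d s y') z))|
          ≤ Cd * M * (E * exp (-(δ * ρx))) := (hmean y').trans (mul_le_mul_of_nonneg_left hw (by positivity))
      have k4 : |∑ z, K (siteOf d ((n + 1) * s) (chart n (windowMap d s y') z')) z * u z| ≤ Kk * (E * exp (-(δ * ρx)) * (C₀ * M)) :=
        calc _ ≤ Kk * (C₀ * M) * exp (-(δ * ∑ i, (((y' i - y₀ i).valMinAbs.natAbs : ℕ) : ℝ))) := hKx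
          _ = Kk * (exp (-(δ * ∑ i, (((y' i - y₀ i).valMinAbs.natAbs : ℕ) : ℝ))) * (C₀ * M)) := by ring
          _ ≤ Kk * (E * exp (-(δ * ρx)) * (C₀ * M)) := mul_le_mul_of_nonneg_left (mul_le_mul_of_nonneg_right hw (by positivity)) hKk0
      rw [hA]
      exact perturbed_laplacian_site_le n a s ha.le hL0 V u f K hu y' z' (hVabs _) k1 k2 k3 k4
    have hl1 : ∑ p ∈ cube q₀ (3 * mm), |u (siteOf d ((n + 1) * s) p)| ≤ Bsum := by
      rw [hB]
      refine sum_cube_le_of_near h3m q₀ (F := fun p => |u (siteOf d ((n + 1) * s) p)|) (fun _ => abs_nonneg _) fun b hb => ?_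
      exact (hL1 b).trans (mul_le_mul_of_nonneg_left (hnear b hb) (by positivity))
    have hint0 := (hI mm hmm1 (fun p' : X d => u (siteOf d ((n + 1) * s) p')) q₀ A Bsum hlap hl1).2 μ
    have e2 : siteOf d ((n + 1) * s) q₀ = x := by rw [hq₀, siteOf_windowMap]
    have e3 : siteOf d ((n + 1) * s) (q₀ + Pi.single μ 1) = x + siteOf d ((n + 1) * s) (e μ) := by rw [siteOf_add, e2]; rfl
    have hint : |u (x + siteOf d ((n + 1) * s) (e μ)) - u x| ≤ CI * ((mm : ℝ) * A + Bsum / (mm : ℝ) ^ (d + 1)) := by rw [← e3, ← e2]; exact hint0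
    have hX0 : 0 ≤ M + L' * (C₀ * M) + a * (Cd * M) := by positivity
    have hmA : ((n : ℝ) + 1) * ((mm : ℝ) * A) ≤ E * exp (-(δ * ρx)) * ((1 / 3) * (M + L' * (C₀ * M) + a * (Cd * M))) := by
      have h2 : ((n : ℝ) + 1) * (mm : ℝ) / ((n : ℝ) + 1) ^ 2 ≤ 1 / 3 := by
        rw [div_le_iff₀ (by positivity)]; have := mul_le_mul_of_nonneg_left hmm_le hn1.le; linarith
      calc ((n : ℝ) + 1) * ((mm : ℝ) * A)
          = E * exp (-(δ * ρx)) * (((n : ℝ) + 1) * (mm : ℝ) / ((n : ℝ) + 1) ^ 2 * (M + L' * (C₀ * M) + a * (Cd * M))) := by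
            rw [hA]; ring
        _ ≤ _ := mul_le_mul_of_nonneg_left (mul_le_mul_of_nonneg_right h2 hX0) (by positivity)
    have hmB : ((n : ℝ) + 1) * (Bsum / (mm : ℝ) ^ (d + 1)) ≤ E * exp (-(δ * ρx)) * (3 ^ d * Cd * 6 ^ (d + 1) * M) := by
      have hr : (n : ℝ) + 1 ≤ 6 * mm := by linarith
      have h1 : ((n : ℝ) + 1) ^ (d + 1) ≤ (6 : ℝ) ^ (d + 1) * (mm : ℝ) ^ (d + 1) := by rw [← mul_pow]; exact pow_le_pow_left₀ hn1.le hr _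
      have h2 : ((n : ℝ) + 1) ^ (d + 1) / (mm : ℝ) ^ (d + 1) ≤ (6 : ℝ) ^ (d + 1) := by rwa [div_le_iff₀ (by positivity)]
      calc ((n : ℝ) + 1) * (Bsum / (mm : ℝ) ^ (d + 1))
          = E * exp (-(δ * ρx)) * (3 ^ d * Cd * M * (((n : ℝ) + 1) ^ (d + 1) / (mm : ℝ) ^ (d + 1))) := by rw [hB, pow_succ]; ring
        _ ≤ E * exp (-(δ * ρx)) * (3 ^ d * Cd * M * (6 : ℝ) ^ (d + 1)) :=
            mul_le_mul_of_nonneg_left (mul_le_mul_of_nonneg_left h2 (by positivity)) (by positivity)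
        _ = _ := by ring
    calc exp (δ * ρx) * (((n : ℝ) + 1) * |u (x + siteOf d ((n + 1) * s) (e μ)) - u x|)
        ≤ exp (δ * ρx) * (((n : ℝ) + 1) * (CI * ((mm : ℝ) * A + Bsum / (mm : ℝ) ^ (d + 1)))) :=
          mul_le_mul_of_nonneg_left (mul_le_mul_of_nonneg_left hint hn1.le) (exp_pos _).le
      _ = exp (δ * ρx) * (CI * (((n : ℝ) + 1) * ((mm : ℝ) * A) + ((n : ℝ) + 1) * (Bsum / (mm : ℝ) ^ (d + 1)))) := by ring
      _ ≤ exp (δ * ρx) * (CI * (E * exp (-(δ * ρx)) * ((1 / 3) * (M + L' * (C₀ * M) + a * (Cd * M)))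
          + E * exp (-(δ * ρx)) * (3 ^ d * Cd * 6 ^ (d + 1) * M))) :=
          mul_le_mul_of_nonneg_left (mul_le_mul_of_nonneg_left (add_le_add hmA hmB) hCI0) (exp_pos _).le
      _ = (exp (δ * ρx) * exp (-(δ * ρx))) * (K₂ * M) := by rw [hK₂]; ring
      _ = K₂ * M := by rw [hw0, one_mul]
      _ ≤ max K₁ K₂ * M := mul_le_mul_of_nonneg_right (le_max_right _ _) hM

/-! ## §2. Toy -/

/-- Toy (`d = 3`, `a = 1`, `λ = 0`, `Λ = 1`, `γ′ = 1`, `ε = 0`, `γ = 2`): the constants exist. -/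
example : ∃ C δ : ℝ, 0 < C ∧ 0 < δ :=
  let ⟨C, δ, hC, hδ, _⟩ := perturbed_gradient_decay (d := 3) le_rfl 1 one_pos (lam := 0) (Lam := 1) (ε := 0) (γ := 2) (γ' := 1)
    (by rw [min_eq_right (by norm_num : (1 : ℝ) ≤ 2)]; norm_num) zero_le_one one_pos le_rfl (by norm_num)
    (by rw [min_eq_right (by norm_num : (1 : ℝ) ≤ 2)]; norm_num)
  ⟨C, δ, hC, hδ⟩

end Summit.QuantumFields.BalabanUV.T4Continuum.NE7b.SupTorusPerturbedGradientDecay
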